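import Summits.FinalStateConjecture.FinalStateConjecture.Theorems.ClusterCompletenessOmegaLimitMultiKerrOfTameRecursOGeneric
import Literature.Geometry.Lorentzian.TameGenericityLocalWindowImmersed
import HarnessLib

/-!
# Route ClusterCompleteness · crux `OmegaLimitMultiKerr` — the crux FROM LOCAL-WINDOW CURVE WITNESSES
# (line `Sketch`, lead c2: the composition, importable)

The crux `ClusterCompleteness.OmegaLimitMultiKerr` (stmt-FinalStateConjecture-17639) stands kernel-reduced
to ONE generic statement (line `birth`, lead c1, `omegaLimitMultiKerr_of_tameRecursOGeneric`, p147761): for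
every order `k` and manifold `X`, TAME-Christodoulou-generically in the admissible class, an MGHD exists and
every MGHD that does not settle in the T2 sense is `TameRecursO k`. Every idea on record for the generic side
of this crux CONSTRUCTS the witness curve through an exceptional datum explicitly and perturbatively — it
controls small parameters only (crux-ideate round 1: `spinless-crumb`'s quarantine + crumb + core-kick
family, `extremality-is-a-threshold`'s annular spin-shift family), and ideator 1 typed the entry point of such
lines as `TameWitnessLocalisation` (punctured-ball witnesses suffice). This file lands that entry point and
the composition behind it, so that a witness-engineering line concludes the crux from the WEAKEST witness
form the tree's tame notion admits:

* `tameWitnessLocalisation` — ideator 1's typed statement (`Cruxes/OmegaLimitMultiKerr/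
  SketchIdeator17639R1K1.lean` §3), DISCHARGED: it is a corollary of the Literature's
  `InitialDataSet.hasTameCodimAtLeastIn_of_localWindow` (window control suffices, any `m`);
* `tameRecursOGeneric_of_localWitnesses` — at each `(k, X)`: if through every admissible datum failing
  "MGHD ∃ ∧ every non-`SettlesT2` MGHD is `TameRecursO k`" pass an end `e`, an `ε > 0` and a CURVE `F`,
  tame on `e`, immersed at `0`, with `F 0 = d`, admissible and good for `0 < ‖c‖ < ε` — NO injectivity
  asked (for curves immersion at `0` gives window injectivity, `exists_window_injective_of_isImmersedAtZero`)
  — then the generic stub's matrix holds at `(k, X)` (`InitialDataSet.exists_tameCurve_of_localWindow`);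
* `omegaLimitMultiKerr_of_localTameRecursOWitnesses` — hence local-window curve witnesses at every
  `(k, X)` give `OmegaLimitMultiKerr` (through p147761).

No new mathematics: bookkeeping over `TameGenericityLocalWindow(Immersed).lean` and the landed reduction.
References: Christodoulou, CQG 16 (1999) A23, p. A24 (positive codimension is local at the exceptional
datum); Dafermos–Luk arXiv:1710.01722, §1.2.1.
-/

-- every `Summit.FinalStateConjecture.FinalStateConjecture.…` name repeats the summit = sub-problem segment (D-0017 layout)
set_option linter.dupNamespace false

noncomputable section

open scoped Manifold ContDiff Topology ENNReal
open Set Filter Function TopologicalSpace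

namespace Summit.FinalStateConjecture.FinalStateConjecture.Theorems.ClusterCompleteness

open Literature.Geometry.Lorentzian
open Summit.FinalStateConjecture.FinalStateConjecture.Theses.ClusterCompleteness (OmegaLimitMultiKerr)

/-- **Tame witnesses are local in the parameter** (ideator 1's typed entry point
`TameWitnessLocalisation`, crux-ideate round 1, DISCHARGED). If through every `d ∈ 𝓔` pass an end `e`,
a curve `F` of `𝓓`-data, tame on `e`, immersed at `0`, with `F 0 = d`, injective on the parameter ball
`‖c‖ < δ` and avoiding `𝓔` for `0 < ‖c‖ < δ`, then `𝓔` has tame codimension at least `1` inside `𝓓`: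
window control suffices (`InitialDataSet.hasTameCodimAtLeastIn_of_localWindow`, radial
reparametrisation of the parameter line into the `δ`-ball). Christodoulou, CQG 16 (1999) A23, p. A24.
[folklore] -/
theorem tameWitnessLocalisation :
    ∀ (X : Type) [TopologicalSpace X] [ChartedSpace E3 X] [IsManifold (𝓡 3) ∞ X]
      (𝓓 𝓔 : Set (InitialDataSet (𝓡 3) X)),
      (∀ d ∈ 𝓔, ∃ (e : AFEnd X) (F : EuclideanSpace ℝ (Fin 1) → InitialDataSet (𝓡 3) X) (δ : ℝ),
        0 < δ ∧ InitialDataSet.IsTameDataFamily e 1 F ∧ InitialDataSet.IsImmersedAtZero 1 F ∧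
        F 0 = d ∧ Set.InjOn F (Metric.ball 0 δ) ∧ (∀ c, F c ∈ 𝓓) ∧
        ∀ c, c ≠ 0 → ‖c‖ < δ → F c ∉ 𝓔) →
      InitialDataSet.HasTameCodimAtLeastIn 𝓓 𝓔 1 := by
  intro X _ _ _ 𝓓 𝓔 h
  refine InitialDataSet.hasTameCodimAtLeastIn_of_localWindow fun d hd ↦ ?_
  obtain ⟨e, F, δ, hδ, hF, himm, h0, hinj, h𝓓, hE⟩ := h d hd
  exact ⟨e, δ, F, hδ, hF, himm, h0,
    fun c c' hc hc' hcc' ↦ hinj (mem_ball_zero_iff.mpr hc) (mem_ball_zero_iff.mpr hc') hcc',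
    fun c _ ↦ h𝓓 c, hE⟩

/-- **The generic stub's matrix from LOCAL-WINDOW CURVE WITNESSES, order by order.** Fix `k` and `X`.
If through every admissible datum `d` failing "an MGHD exists and every non-settling (T2) MGHD is
`TameRecursO k`" pass an end `e`, an `ε > 0` and a curve `F : ℝ¹ → InitialDataSet (𝓡 3) X`, tame on `e`,
immersed at `0`, with `F 0 = d`, whose members with `‖c‖ < ε` are admissible and whose members with
`0 < ‖c‖ < ε` satisfy that property, then the property is tame-Christodoulou-generic (codimension `1`) in
the admissible class. No injectivity is asked: a curve immersed at `0` is injective on a window, and window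
control suffices (`InitialDataSet.exists_tameCurve_of_localWindow`). Christodoulou, CQG 16 (1999) A23,
p. A24. [folklore] -/
theorem tameRecursOGeneric_of_localWitnesses :
    ∀ (k : ℕ) (X : Type) [TopologicalSpace X] [ChartedSpace E3 X] [IsManifold (𝓡 3) ∞ X]
      [T2Space X] [SecondCountableTopology X] [ConnectedSpace X],
      (∀ d ∈ admissibleVacuumData X,
        ¬ ((∃ 𝒟 : VacuumCauchyDevelopment d, 𝒟.IsMaximal) ∧
            ∀ 𝒟 : VacuumCauchyDevelopment d, 𝒟.IsMaximal → ¬ SettlesT2 𝒟 → TameRecursO k 𝒟) →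
        ∃ (e : AFEnd X) (ε : ℝ) (F : EuclideanSpace ℝ (Fin 1) → InitialDataSet (𝓡 3) X),
          0 < ε ∧ InitialDataSet.IsTameDataFamily e 1 F ∧ InitialDataSet.IsImmersedAtZero 1 F ∧
          F 0 = d ∧ (∀ c, ‖c‖ < ε → F c ∈ admissibleVacuumData X) ∧
          ∀ c, c ≠ 0 → ‖c‖ < ε →
            (∃ 𝒟 : VacuumCauchyDevelopment (F c), 𝒟.IsMaximal) ∧
              ∀ 𝒟 : VacuumCauchyDevelopment (F c), 𝒟.IsMaximal → ¬ SettlesT2 𝒟 →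
                TameRecursO k 𝒟) →
      InitialDataSet.IsTameChristodoulouGeneric (admissibleVacuumData X)
        (fun D ↦ (∃ 𝒟 : VacuumCauchyDevelopment D, 𝒟.IsMaximal) ∧
          ∀ 𝒟 : VacuumCauchyDevelopment D, 𝒟.IsMaximal → ¬ SettlesT2 𝒟 → TameRecursO k 𝒟) 1 := by
  intro k X _ _ _ _ _ _ h d hd
  obtain ⟨e, ε, F, hε, hF, himm, h0, h𝓓, hP⟩ := h d hd.1 hd.2
  obtain ⟨F', hF', hF'0, hinj', himm', h𝓓', hP'⟩ :=
    InitialDataSet.exists_tameCurve_of_localWindow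
      (P := fun D ↦ (∃ 𝒟 : VacuumCauchyDevelopment D, 𝒟.IsMaximal) ∧
        ∀ 𝒟 : VacuumCauchyDevelopment D, 𝒟.IsMaximal → ¬ SettlesT2 𝒟 → TameRecursO k 𝒟)
      hF himm hε h𝓓 hP
  exact ⟨e, F', hF', himm', hF'0.trans h0, hinj', h𝓓', fun c hc hmem ↦ hmem.2 (hP' c hc)⟩

/-- **The crux from local-window curve witnesses** (line `Sketch`, composition). If for every order `k`
and manifold `X`, through every admissible datum failing "MGHD ∃ ∧ every non-`SettlesT2` MGHD is
`TameRecursO k`" passes a tame, immersed curve with base point `d`, admissible and good on a punctured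
parameter window, then `ClusterCompleteness.OmegaLimitMultiKerr` holds
(`tameRecursOGeneric_of_localWitnesses` at every `(k, X)`, then
`omegaLimitMultiKerr_of_tameRecursOGeneric`, p147761). [folklore] -/
theorem omegaLimitMultiKerr_of_localTameRecursOWitnesses :
    (∀ (k : ℕ) (X : Type) [TopologicalSpace X] [ChartedSpace E3 X] [IsManifold (𝓡 3) ∞ X]
      [T2Space X] [SecondCountableTopology X] [ConnectedSpace X],
      ∀ d ∈ admissibleVacuumData X,
        ¬ ((∃ 𝒟 : VacuumCauchyDevelopment d, 𝒟.IsMaximal) ∧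
            ∀ 𝒟 : VacuumCauchyDevelopment d, 𝒟.IsMaximal → ¬ SettlesT2 𝒟 → TameRecursO k 𝒟) →
        ∃ (e : AFEnd X) (ε : ℝ) (F : EuclideanSpace ℝ (Fin 1) → InitialDataSet (𝓡 3) X),
          0 < ε ∧ InitialDataSet.IsTameDataFamily e 1 F ∧ InitialDataSet.IsImmersedAtZero 1 F ∧
          F 0 = d ∧ (∀ c, ‖c‖ < ε → F c ∈ admissibleVacuumData X) ∧
          ∀ c, c ≠ 0 → ‖c‖ < ε →
            (∃ 𝒟 : VacuumCauchyDevelopment (F c), 𝒟.IsMaximal) ∧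
              ∀ 𝒟 : VacuumCauchyDevelopment (F c), 𝒟.IsMaximal → ¬ SettlesT2 𝒟 →
                TameRecursO k 𝒟) →
      OmegaLimitMultiKerr :=
  fun h ↦ omegaLimitMultiKerr_of_tameRecursOGeneric fun k X _ _ _ _ _ _ ↦
    tameRecursOGeneric_of_localWitnesses k X (h k X)

end Summit.FinalStateConjecture.FinalStateConjecture.Theorems.ClusterCompleteness

end
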